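import Mathlib
import Summits.AnomalousDissipation.AnomalousDissipation.Theses.PointSink
import Summits.AnomalousDissipation.AnomalousDissipation.Theorems.SolitonTransplant.Negative.PointSinkLocalEnergy
import Summits.AnomalousDissipation.AnomalousDissipation.Theorems.CoherentStatesSteadyNegTameOffThinSets
import Literature.Analysis.FunctionSpaces.TorusConvolution

/-!
# `PointSink.SolitonTransplant` (stmt-AnomalousDissipation-19035): the energy flux into the sink
equals the work of the stirring — a design constraint for every line of the crux

Lead record (line `Sketch`, continuation seat c1; observation (O3) of `LeadAnalysisC1.md`).
The conclusion of the crux is the target `X = PointSinkZerothLaw`: steady classical states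
`(u_j, p_j)` of the `f`-forced Navier–Stokes system on `T³` (`f` smooth, FIXED), `ν_j → 0`, with
bounded energy `∫‖u_j‖² ≤ E`, a dissipation floor `ε ≤ ν_j‖∇u_j‖₂²` and point concentration of the
dissipation at `x₀` (`ν_j ∫_{dist ≥ r} ∑‖∂ᵢu_j‖² → 0` for every `r > 0`).

* `torusFDeriv_eq_zero_of_eventuallyEq` — locality of the torus derivative (a function that is
  locally constant near `x` has `Dχ(x) = 0`).
* `pointSink_flux_add_work_tendsto_zero` — for EVERY smooth weight `χ` vanishing on a ball
  `B_r(x₀)` around the sink, the weighted steady energy identity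
  (`steady_weighted_energy_identity`, file `PointSinkLocalEnergy.lean`)
  `∫(½‖u_j‖²+p_j)Dχ[u_j] = ν_j∫χ∑‖∂ᵢu_j‖² + ν_j∫∑∂ᵢχ⟪u_j,∂ᵢu_j⟫ − ∫χ⟪f,u_j⟫` loses its two
  viscous terms in the limit: the first is `≤ ‖χ‖_∞ ν_j∫_{dist≥r}∑‖∂ᵢu_j‖² → 0` (concentration),
  the second is `≤ ‖Dχ‖_∞ (3√ν_j E/2 + √ν_j · ν_j∫_{dist≥r}∑‖∂ᵢu_j‖²/2) → 0` (Young, bounded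
  energy, concentration). Hence `∫(½‖u_j‖²+p_j)Dχ[u_j] + ∫χ⟪f,u_j⟫ → 0`: asymptotically, the
  OUTWARD energy flux through the level sets of `χ` is minus the `χ`-weighted work. No floor and
  no boundedness is used.
The consequences under the dissipation floor (the floor must cross every shell separating
`supp f` from the sink; no flux-less separating shell) are in the companion file
`PointSinkEnergyFluxShell.lean`.

What a prover must respect (design constraint for the crux's lines): in any scaffold to be
realised by such states, the collar between the stirring region and the cone must transmit the
full power `ε`; a completion AT REST outside `B_{r₁}(x₀)` with `f ≡ 0` on a larger ball (the
zero-force free-space completion of line `Sketch` planted with a disjoint stirring cell) can only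
be realised by states whose cubic flux `(½‖u‖²+p)u` stays non-compact on every separating shell —
transport by triple correlations alone. Classification: negative lemma / design constraint (no
verdict change). [folklore]
-/

set_option linter.dupNamespace false  -- `Summit.AnomalousDissipation.AnomalousDissipation` is the mandated summit/problem namespace

noncomputable section

open MeasureTheory Metric Filter Topology Set
open scoped InnerProductSpace
open Literature.Analysis.FunctionSpaces Literature.Analysis.FunctionSpaces.Torus

namespace Summit.AnomalousDissipation.AnomalousDissipation.Theorems.SolitonTransplant.Negative

/-! ## Locality of the torus derivative -/

section Locality

variable {d : Type*} [Fintype d]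

omit [Fintype d] in
/-- **Locality of the torus derivative.** If `χ` agrees with a constant near `x`, then
`Dχ(x) = 0` (the re-centred lift `v ↦ χ(x + proj v)` is eventually constant at `0`). [folklore] -/
theorem torusFDeriv_eq_zero_of_eventuallyEq {F : Type*} [NormedAddCommGroup F] [NormedSpace ℝ F]
    {χ : UnitAddTorus d → F} {x : UnitAddTorus d} {c : F} (h : ∀ᶠ y in 𝓝 x, χ y = c) :
    Torus.fderiv χ x = 0 := by
  have hg : Continuous fun v : EuclideanSpace ℝ d => x + proj v :=
    continuous_const.add continuous_proj
  have ht : Tendsto (fun v : EuclideanSpace ℝ d => x + proj v) (𝓝 0) (𝓝 x) := by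
    have h0 := hg.tendsto (0 : EuclideanSpace ℝ d)
    rwa [proj_zero, add_zero] at h0
  have hev : liftAt χ x =ᶠ[𝓝 0] fun _ => c := by
    filter_upwards [ht.eventually h] with v hv
    simpa [liftAt_apply] using hv
  unfold Torus.fderiv
  rw [hev.fderiv_eq]
  simp

variable [DecidableEq d]

/-- For a smooth `χ` agreeing with a constant near `x`, every partial derivative vanishes at `x`.
[folklore] -/
theorem partialDeriv_eq_zero_of_eventuallyEq {χ : UnitAddTorus d → ℝ} (hχ : IsSmooth χ)
    {x : UnitAddTorus d} {c : ℝ} (h : ∀ᶠ y in 𝓝 x, χ y = c) (i : d) : partialDeriv i χ x = 0 := by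
  rw [partialDeriv_eq_fderiv_apply (hχ.isContDiff (by simp)), torusFDeriv_eq_zero_of_eventuallyEq h]
  simp

end Locality

/-! ## The flux–work asymptotics at a point sink -/

section Flux

open Summit.AnomalousDissipation.AnomalousDissipation.Theorems

/-- Young-type absorption for the viscous transport term: for `s ≥ 0` and reals `a, b`,
`s² a b ≤ (s a² + s³ b²)/2` (`= ` half of `s (a − s b)² ≥ 0` rearranged). [folklore] -/
theorem sq_mul_mul_le' {s a b : ℝ} (hs : 0 ≤ s) :
    s ^ 2 * a * b ≤ (s * a ^ 2 + s ^ 3 * b ^ 2) / 2 := by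
  nlinarith [mul_nonneg hs (sq_nonneg (a - s * b))]

/-- **Energy flux into the sink = work of the stirring, asymptotically.** Let `(u_j, p_j)` be
steady classical states of the `f`-forced Navier–Stokes system on `T³` (`f` smooth) with
viscosities `ν_j > 0`, `ν_j → 0`, bounded energy `∫‖u_j‖² ≤ E` and point concentration of the
dissipation at `x₀`. Then for every smooth weight `χ` vanishing on a ball `B_r(x₀)`, `r > 0`,
`∫(½‖u_j‖²+p_j)Dχ[u_j] + ∫χ⟪f,u_j⟫ → 0` as `j → ∞`: in the weighted steady energy identity
(`steady_weighted_energy_identity`) the weighted dissipation is `≤ ‖χ‖_∞ ν_j∫_{dist≥r}∑‖∂ᵢu_j‖²`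
and the viscous transport is `≤ ‖Dχ‖_∞(3√ν_j E + √ν_j ν_j∫_{dist≥r}∑‖∂ᵢu_j‖²)/2`, both `→ 0`.
No dissipation floor and no boundedness of the states is used. [folklore] -/
theorem pointSink_flux_add_work_tendsto_zero
    (f : UnitAddTorus (Fin 3) → EuclideanSpace ℝ (Fin 3)) (x₀ : UnitAddTorus (Fin 3))
    (ν : ℕ → ℝ) (u : ℕ → UnitAddTorus (Fin 3) → EuclideanSpace ℝ (Fin 3))
    (p : ℕ → UnitAddTorus (Fin 3) → ℝ) (hν : ∀ j, 0 < ν j) (hν0 : Tendsto ν atTop (𝓝 0))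
    (hsol : ∀ j, IsClassicalNSSolutionOn Set.univ (ν j) (fun _ => f) (fun _ => u j)
      (fun _ => p j))
    {E : ℝ} (hE : ∀ j, ∫ x, ‖u j x‖ ^ 2 ≤ E)
    (hconc : ∀ r : ℝ, 0 < r → Tendsto (fun j => ν j *
      ∫ x in {x : UnitAddTorus (Fin 3) | r ≤ dist x x₀}, ∑ i, ‖partialDeriv i (u j) x‖ ^ 2)
      atTop (𝓝 0))
    {χ : UnitAddTorus (Fin 3) → ℝ} (hχ : IsSmooth χ) {r : ℝ} (hr : 0 < r)
    (hχ0 : ∀ x, dist x x₀ < r → χ x = 0) :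
    Tendsto (fun j => (∫ x, (2⁻¹ * ‖u j x‖ ^ 2 + p j x) * Torus.fderiv χ x (u j x)) +
      ∫ x, χ x * ⟪f x, u j x⟫_ℝ) atTop (𝓝 0) := by
  -- smoothness of the states
  have hu : ∀ j, IsSmooth (u j) := fun j =>
    (hsol j).smooth_velocity.isSmooth_slice (Set.mem_univ (0 : ℝ))
  have hχ1 : IsContDiff 1 χ := hχ.isContDiff (by simp)
  -- bounds for the weight and its derivative (continuous on the compact torus)
  obtain ⟨Cχ, hCχ'⟩ := (isCompact_range hχ.continuous.norm).bddAbove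
  have hCχ : ∀ x, |χ x| ≤ Cχ := fun x => (Real.norm_eq_abs _).symm.le.trans (hCχ' ⟨x, rfl⟩)
  have hCχ0 : 0 ≤ Cχ := (abs_nonneg _).trans (hCχ x₀)
  have hDc : Continuous (Torus.fderiv χ) := hχ1.continuous_fderiv
  obtain ⟨Cd, hCd'⟩ := (isCompact_range hDc.norm).bddAbove
  have hCd : ∀ x, ‖Torus.fderiv χ x‖ ≤ Cd := fun x => hCd' ⟨x, rfl⟩
  have hCd0 : 0 ≤ Cd := (norm_nonneg _).trans (hCd x₀)
  -- the derivative of the weight vanishes on the ball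
  have hχD0 : ∀ x, dist x x₀ < r → ∀ i, partialDeriv i χ x = 0 := by
    intro x hx i
    refine partialDeriv_eq_zero_of_eventuallyEq hχ (c := 0) ?_ i
    have ho : IsOpen {y : UnitAddTorus (Fin 3) | dist y x₀ < r} :=
      isOpen_lt (continuous_id.dist continuous_const) continuous_const
    exact Filter.eventually_of_mem (ho.mem_nhds hx) fun y hy => hχ0 y hy
  have hdχ : ∀ i x, |partialDeriv i χ x| ≤ Cd := by
    intro i x
    rw [partialDeriv_eq_fderiv_apply hχ1]
    calc |Torus.fderiv χ x (EuclideanSpace.single i 1)|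
        = ‖Torus.fderiv χ x (EuclideanSpace.single i 1)‖ := (Real.norm_eq_abs _).symm
      _ ≤ ‖Torus.fderiv χ x‖ * ‖EuclideanSpace.single i (1 : ℝ)‖ := ContinuousLinearMap.le_opNorm _ _
      _ ≤ Cd * 1 := by
          gcongr
          · exact hCd x
          · rw [PiLp.norm_single, norm_one]
      _ = Cd := mul_one _
  -- the exterior set and its indicator
  set A : Set (UnitAddTorus (Fin 3)) := {x | r ≤ dist x x₀} with hA_def
  have hAm : MeasurableSet A :=
    (isClosed_le continuous_const (continuous_id.dist continuous_const)).measurableSet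
  have hAc : ∀ x, x ∉ A → dist x x₀ < r := fun x hx => by
    simpa [hA_def] using hx
  -- notation for the terms of the identity
  set FL : ℕ → ℝ := fun j => ∫ x, (2⁻¹ * ‖u j x‖ ^ 2 + p j x) * Torus.fderiv χ x (u j x)
    with hFL_def
  set T1 : ℕ → ℝ := fun j => ∫ x, χ x * ∑ i, ‖partialDeriv i (u j) x‖ ^ 2 with hT1_def
  set T2 : ℕ → ℝ := fun j => ∫ x, ∑ i, partialDeriv i χ x * ⟪u j x, partialDeriv i (u j) x⟫_ℝ
    with hT2_def
  set W : ℕ → ℝ := fun j => ∫ x, χ x * ⟪f x, u j x⟫_ℝ with hW_def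
  set G : ℕ → ℝ := fun j => ∫ x in A, ∑ i, ‖partialDeriv i (u j) x‖ ^ 2 with hG_def
  have hid : ∀ j, FL j = ν j * T1 j + ν j * T2 j - W j := fun j =>
    steady_weighted_energy_identity (hsol j) hχ
  -- the gradient density
  have hF : ∀ j, IsSmooth (fun x => ∑ i, ‖partialDeriv i (u j) x‖ ^ 2) := fun j =>
    ContDiff.sum (s := (Finset.univ : Finset (Fin 3)))
      (fun i (_ : i ∈ Finset.univ) => ((hu j).partialDeriv i).norm_sq)
  have hF0 : ∀ j x, 0 ≤ ∑ i, ‖partialDeriv i (u j) x‖ ^ 2 := fun j x =>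
    Finset.sum_nonneg fun i _ => sq_nonneg _
  have hG0 : ∀ j, 0 ≤ G j := fun j => setIntegral_nonneg hAm fun x _ => hF0 j x
  -- (i) the weighted dissipation: `|T1 j| ≤ Cχ G j`
  have hT1 : ∀ j, |T1 j| ≤ Cχ * G j := by
    intro j
    have hbound : ∀ x, ‖χ x * ∑ i, ‖partialDeriv i (u j) x‖ ^ 2‖ ≤
        Cχ * A.indicator (fun x => ∑ i, ‖partialDeriv i (u j) x‖ ^ 2) x := by
      intro x
      by_cases hx : x ∈ A
      · rw [Set.indicator_of_mem hx, norm_mul, Real.norm_eq_abs, Real.norm_eq_abs,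
          abs_of_nonneg (hF0 j x)]
        exact mul_le_mul_of_nonneg_right (hCχ x) (hF0 j x)
      · rw [Set.indicator_of_notMem hx, hχ0 x (hAc x hx)]
        simp
    have hint : Integrable (fun x => Cχ * A.indicator (fun x => ∑ i, ‖partialDeriv i (u j) x‖ ^ 2) x)
        volume := ((hF j).integrable.indicator hAm).const_mul _
    have h := norm_integral_le_of_norm_le hint (ae_of_all _ hbound)
    rw [integral_const_mul, integral_indicator hAm, Real.norm_eq_abs] at h
    exact h
  -- (ii) the viscous transport: `|ν T2 j| ≤ Cd (3 √ν E + √ν (ν G)) / 2`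
  have hT2 : ∀ j, |ν j * T2 j| ≤
      Cd * (3 * (Real.sqrt (ν j) * E) + Real.sqrt (ν j) * (ν j * G j)) / 2 := by
    intro j
    set s : ℝ := Real.sqrt (ν j) with hs_def
    have hs0 : 0 ≤ s := Real.sqrt_nonneg _
    have hs2 : s ^ 2 = ν j := Real.sq_sqrt (hν j).le
    -- pointwise Young bound, with the indicator of `A` on the gradient part
    have hpt : ∀ x, ‖ν j * ∑ i, partialDeriv i χ x * ⟪u j x, partialDeriv i (u j) x⟫_ℝ‖ ≤
        ∑ i, Cd * ((s * ‖u j x‖ ^ 2 +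
          s ^ 3 * A.indicator (fun x => ‖partialDeriv i (u j) x‖ ^ 2) x) / 2) := by
      intro x
      by_cases hx : x ∈ A
      · simp_rw [Set.indicator_of_mem hx]
        rw [Real.norm_eq_abs, abs_mul, abs_of_pos (hν j)]
        calc ν j * |∑ i, partialDeriv i χ x * ⟪u j x, partialDeriv i (u j) x⟫_ℝ|
            ≤ ν j * ∑ i, |partialDeriv i χ x * ⟪u j x, partialDeriv i (u j) x⟫_ℝ| := by
              gcongr
              · exact (hν j).le
              · exact Finset.abs_sum_le_sum_abs _ _
          _ = ∑ i, ν j * |partialDeriv i χ x * ⟪u j x, partialDeriv i (u j) x⟫_ℝ| :=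
              Finset.mul_sum _ _ _
          _ ≤ _ := Finset.sum_le_sum fun i _ => ?_
        rw [abs_mul]
        have ha : 0 ≤ ‖partialDeriv i (u j) x‖ := norm_nonneg _
        have h1 : |⟪u j x, partialDeriv i (u j) x⟫_ℝ| ≤ ‖u j x‖ * ‖partialDeriv i (u j) x‖ :=
          abs_real_inner_le_norm _ _
        calc ν j * (|partialDeriv i χ x| * |⟪u j x, partialDeriv i (u j) x⟫_ℝ|)
            ≤ ν j * (Cd * (‖u j x‖ * ‖partialDeriv i (u j) x‖)) := by
              gcongr
              · exact (hν j).le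
              · exact hdχ i x
          _ = Cd * (s ^ 2 * ‖u j x‖ * ‖partialDeriv i (u j) x‖) := by rw [hs2]; ring
          _ ≤ Cd * ((s * ‖u j x‖ ^ 2 + s ^ 3 * ‖partialDeriv i (u j) x‖ ^ 2) / 2) :=
              mul_le_mul_of_nonneg_left (sq_mul_mul_le' hs0) hCd0
      · -- inside the ball the derivative of the weight vanishes
        have hzero : ∑ i, partialDeriv i χ x * ⟪u j x, partialDeriv i (u j) x⟫_ℝ = 0 :=
          Finset.sum_eq_zero fun i _ => by rw [hχD0 x (hAc x hx) i, zero_mul]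
        rw [hzero, mul_zero, norm_zero]
        refine Finset.sum_nonneg fun i _ => mul_nonneg hCd0 (div_nonneg (add_nonneg ?_ ?_) zero_le_two)
        · exact mul_nonneg hs0 (sq_nonneg _)
        · exact mul_nonneg (pow_nonneg hs0 3) (Set.indicator_nonneg (fun _ _ => sq_nonneg _) _)
    have hU2 : Integrable (fun x => ‖u j x‖ ^ 2) volume := (hu j).norm_sq.integrable
    have hGi : ∀ i, Integrable (fun x => A.indicator (fun x => ‖partialDeriv i (u j) x‖ ^ 2) x)
        volume := fun i => ((hu j).partialDeriv i).norm_sq.integrable.indicator hAm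
    have hIi : ∀ i, Integrable (fun x => Cd * ((s * ‖u j x‖ ^ 2 +
        s ^ 3 * A.indicator (fun x => ‖partialDeriv i (u j) x‖ ^ 2) x) / 2)) volume := fun i =>
      (((hU2.const_mul s).add ((hGi i).const_mul _)).div_const _).const_mul _
    have hint : Integrable (fun x => ∑ i, Cd * ((s * ‖u j x‖ ^ 2 +
        s ^ 3 * A.indicator (fun x => ‖partialDeriv i (u j) x‖ ^ 2) x) / 2)) volume :=
      integrable_finsetSum _ fun i _ => hIi i
    have h := norm_integral_le_of_norm_le hint (ae_of_all _ hpt)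
    rw [integral_const_mul, Real.norm_eq_abs] at h
    refine h.trans ?_
    -- evaluate the right-hand side
    rw [integral_finsetSum _ fun i _ => hIi i]
    have hterm : ∀ i, ∫ x, Cd * ((s * ‖u j x‖ ^ 2 +
        s ^ 3 * A.indicator (fun x => ‖partialDeriv i (u j) x‖ ^ 2) x) / 2) =
        Cd * ((s * ∫ x, ‖u j x‖ ^ 2) +
          s ^ 3 * ∫ x in A, ‖partialDeriv i (u j) x‖ ^ 2) / 2 := by
      intro i
      rw [integral_const_mul, integral_div, integral_add (hU2.const_mul s) ((hGi i).const_mul _),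
        integral_const_mul, integral_const_mul, integral_indicator hAm]
      ring
    simp_rw [hterm]
    have hGsum : ∑ i, ∫ x in A, ‖partialDeriv i (u j) x‖ ^ 2 = G j := by
      simp only [hG_def]
      rw [integral_finsetSum _ fun i _ =>
        (((hu j).partialDeriv i).norm_sq.integrable.integrableOn)]
    have hsum : ∑ i : Fin 3, Cd * ((s * ∫ x, ‖u j x‖ ^ 2) +
        s ^ 3 * ∫ x in A, ‖partialDeriv i (u j) x‖ ^ 2) / 2 =
        Cd * (3 * (s * ∫ x, ‖u j x‖ ^ 2) + s ^ 3 * G j) / 2 := by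
      rw [← hGsum]
      simp only [Fin.sum_univ_three]
      ring
    rw [hsum]
    have hs3 : s ^ 3 * G j = s * (ν j * G j) := by rw [← hs2]; ring
    rw [hs3]
    have hEj : s * ∫ x, ‖u j x‖ ^ 2 ≤ s * E := mul_le_mul_of_nonneg_left (hE j) hs0
    have : Cd * (3 * (s * ∫ x, ‖u j x‖ ^ 2) + s * (ν j * G j)) / 2 ≤
        Cd * (3 * (s * E) + s * (ν j * G j)) / 2 := by
      gcongr
    exact this
  -- the dominating vanishing sequence
  set o : ℕ → ℝ := fun j => ν j * (Cχ * G j) +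
      Cd * (3 * (Real.sqrt (ν j) * E) + Real.sqrt (ν j) * (ν j * G j)) / 2 with ho_def
  have hνG : Tendsto (fun j => ν j * G j) atTop (𝓝 0) := hconc r hr
  have hsq : Tendsto (fun j => Real.sqrt (ν j)) atTop (𝓝 0) := by
    have h := (Real.continuous_sqrt.tendsto 0).comp hν0
    rw [Real.sqrt_zero] at h
    exact h
  have hlim : Tendsto o atTop (𝓝 0) := by
    have h1 : Tendsto (fun j => ν j * (Cχ * G j)) atTop (𝓝 0) := by
      have h := hνG.const_mul Cχ
      rw [mul_zero] at h
      refine h.congr fun j => ?_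
      ring
    have h2 : Tendsto (fun j => Cd * (3 * (Real.sqrt (ν j) * E) +
        Real.sqrt (ν j) * (ν j * G j)) / 2) atTop (𝓝 0) := by
      have ha : Tendsto (fun j => 3 * (Real.sqrt (ν j) * E)) atTop (𝓝 0) := by
        simpa using (hsq.mul_const E).const_mul 3
      have hb : Tendsto (fun j => Real.sqrt (ν j) * (ν j * G j)) atTop (𝓝 0) := by
        simpa using hsq.mul hνG
      simpa using ((ha.add hb).const_mul Cd).div_const 2
    simpa [ho_def] using h1.add h2
  -- squeeze
  have hbound : ∀ j, |FL j + W j| ≤ o j := by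
    intro j
    have h1 : FL j + W j = ν j * T1 j + ν j * T2 j := by rw [hid j]; ring
    rw [h1]
    have h2 : |ν j * T1 j| ≤ ν j * (Cχ * G j) := by
      rw [abs_mul, abs_of_pos (hν j)]
      exact mul_le_mul_of_nonneg_left (hT1 j) (hν j).le
    calc |ν j * T1 j + ν j * T2 j| ≤ |ν j * T1 j| + |ν j * T2 j| := abs_add_le _ _
      _ ≤ o j := by simp only [ho_def]; linarith [hT2 j]
  refine squeeze_zero_norm (fun j => ?_) hlim
  rw [Real.norm_eq_abs]
  exact hbound j

end Flux

end Summit.AnomalousDissipation.AnomalousDissipation.Theorems.SolitonTransplant.Negative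

end
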